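import Literature.MathematicalPhysics.QuantumFieldTheory.LatticeLangevinDynamics
import Literature.Probability.Process.ItoIntegralIntegrandSum
import Literature.Probability.Process.ItoIntegralIntegratorLinearity
import HarnessLib

/-!
# Complex-valued Itô integrals against a real integrator (`IsItoIntegralC`): uniqueness, linear combinations of
# integrands with complex coefficients, conjugation of a matrix of integrals by constant matrices, linear
# combinations of integrators

Topic `MathematicalPhysics/QuantumFieldTheory`; theorems only.  The tree's link SDEs (`LinkSDE.IsSolution`,
`LatticeLangevinDynamics`) are written entrywise in matrix coordinates with the predicate
`IsItoIntegralC H B J 𝓕 P` := real and imaginary parts of `J` are the characterised real Itô integrals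
(`Literature.Probability.Process.IsItoIntegral`) of those of `H` against the real integrator `B`.  This file is the
small API of that predicate needed to transport the Itô integral equations of a solution under a CONSTANT LINEAR
CHANGE OF COORDINATES (e.g. a lattice gauge transformation `Q_e ↦ ρ(h_x) Q_e ρ(h_y)ᴴ`, seat `ym-line-csu-p1` g11):

* `IsItoIntegralC.ae_eq` — uniqueness up to indistinguishability (from `IsItoIntegral.unique_holds`);
* `IsItoIntegralC.sum_left_of_martingale` — `∫ (Σₐ cₐ Hₐ) dB = Σₐ cₐ ∫ Hₐ dB` for complex constants `cₐ` and a
  nonempty finite family of martingale integrals with Borel paths (real and imaginary parts via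
  `IsItoIntegral.sum_left_of_martingale`);
* `IsItoIntegralC.conj_entry_of_martingale` — ★ if `I_{kl} = ∫ M_{kl} dB` entrywise for a matrix-valued integrand
  `M`, then `(A I C)_{ij} = ∫ (A M C)_{ij} dB` for constant matrices `A`, `C`;
* `IsItoIntegralC.sum_right_of_martingale` — `∫ H d(Σₐ cₐ Bₐ) = Σₐ cₐ ∫ H dBₐ` for real `cₐ`
  (from `IsItoIntegral.sum_right_of_martingale`).

[folklore] (Revuz–Yor, Ch. IV Prop. (2.10)(i), eq. (2.4), Thm. (2.2), read componentwise); nothing here bears on any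
summit.

## References
* D. Revuz, M. Yor, *Continuous Martingales and Brownian Motion* (3rd ed., 1999), Ch. IV, Thm. (2.2), eq. (2.4),
  Prop. (2.10)(i), Prop. (2.13).
-/

noncomputable section

namespace Literature.MathematicalPhysics.QuantumFieldTheory

open _root_.MeasureTheory Filter Finset Literature.Probability.Process
open scoped NNReal BigOperators

variable {Ω : Type*} {m : MeasurableSpace Ω} {𝓕 : Filtration ℝ≥0 m} {P : Measure Ω} {B : ℝ≥0 → Ω → ℝ}

/-! ## Uniqueness -/

/-- **Uniqueness of the complex Itô integral** up to indistinguishability: two `IsItoIntegralC` processes with the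
same integrand and integrator agree at all times outside a null set (real and imaginary parts separately, by
`IsItoIntegral.unique_holds`). [cite: RevuzYor1999, Ch. IV Thm. (2.2)] -/
theorem IsItoIntegralC.ae_eq {H J J' : ℝ≥0 → Ω → ℂ} (h : IsItoIntegralC H B J 𝓕 P)
    (h' : IsItoIntegralC H B J' 𝓕 P) : ∀ᵐ ω ∂P, ∀ t, J t ω = J' t ω := by
  filter_upwards [IsItoIntegral.unique_holds h.1 h'.1, IsItoIntegral.unique_holds h.2 h'.2] with ω h1 h2
  intro t
  exact Complex.ext (h1 t) (h2 t)

/-- The real and imaginary parts of a process with Borel paths in `ℂ` have Borel paths. [folklore] -/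
private theorem measurable_re_im_path {H : ℝ≥0 → Ω → ℂ} (hH : ∀ ω, Measurable fun r : ℝ => H r.toNNReal ω) (ω : Ω) :
    (Measurable fun r : ℝ => (H r.toNNReal ω).re) ∧ Measurable fun r : ℝ => (H r.toNNReal ω).im :=
  ⟨Complex.measurable_re.comp (hH ω), Complex.measurable_im.comp (hH ω)⟩

/-! ## Linear combinations of integrands with complex coefficients -/

/-- ★ **`∫ (Σₐ cₐ Hₐ) dB = Σₐ cₐ ∫ Hₐ dB` for complex constants** (nonempty finite family of complex Itô integrals
whose real and imaginary parts are martingales; integrands with Borel paths): the combination is an `IsItoIntegralC`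
and its real and imaginary parts are martingales.  Real part `Σₐ (Re cₐ · Re Hₐ − Im cₐ · Im Hₐ)`, imaginary part
`Σₐ (Re cₐ · Im Hₐ + Im cₐ · Re Hₐ)`, each a real combination (`IsItoIntegral.sum_left_of_martingale`).
[cite: RevuzYor1999, Ch. IV Prop. (2.10)(i)] -/
theorem IsItoIntegralC.sum_left_of_martingale {ι : Type*} {s : Finset ι} (hs : s.Nonempty) (c : ι → ℂ)
    {Hf Jf : ι → ℝ≥0 → Ω → ℂ}
    (hJ : ∀ a ∈ s, IsItoIntegralC (Hf a) B (Jf a) 𝓕 P)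
    (hMre : ∀ a ∈ s, Martingale (fun t ω => (Jf a t ω).re) 𝓕 P)
    (hMim : ∀ a ∈ s, Martingale (fun t ω => (Jf a t ω).im) 𝓕 P)
    (hH : ∀ a ∈ s, ∀ ω, Measurable fun r : ℝ => Hf a r.toNNReal ω) :
    IsItoIntegralC (fun t ω => ∑ a ∈ s, c a * Hf a t ω) B (fun t ω => ∑ a ∈ s, c a * Jf a t ω) 𝓕 P ∧
      Martingale (fun t ω => (∑ a ∈ s, c a * Jf a t ω).re) 𝓕 P ∧
      Martingale (fun t ω => (∑ a ∈ s, c a * Jf a t ω).im) 𝓕 P := by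
  have hHre : ∀ a ∈ s, ∀ ω, Measurable fun r : ℝ => (Hf a r.toNNReal ω).re := fun a ha ω =>
    (measurable_re_im_path (hH a ha) ω).1
  have hHim : ∀ a ∈ s, ∀ ω, Measurable fun r : ℝ => (Hf a r.toNNReal ω).im := fun a ha ω =>
    (measurable_re_im_path (hH a ha) ω).2
  -- the four real combinations
  have h1 := IsItoIntegral.sum_left_of_martingale hs (fun a => (c a).re) (Hf := fun a t ω => (Hf a t ω).re)
    (Jf := fun a t ω => (Jf a t ω).re) (fun a ha => (hJ a ha).1) hMre hHre
  have h2 := IsItoIntegral.sum_left_of_martingale hs (fun a => -(c a).im) (Hf := fun a t ω => (Hf a t ω).im)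
    (Jf := fun a t ω => (Jf a t ω).im) (fun a ha => (hJ a ha).2) hMim hHim
  have h3 := IsItoIntegral.sum_left_of_martingale hs (fun a => (c a).re) (Hf := fun a t ω => (Hf a t ω).im)
    (Jf := fun a t ω => (Jf a t ω).im) (fun a ha => (hJ a ha).2) hMim hHim
  have h4 := IsItoIntegral.sum_left_of_martingale hs (fun a => (c a).im) (Hf := fun a t ω => (Hf a t ω).re)
    (Jf := fun a t ω => (Jf a t ω).re) (fun a ha => (hJ a ha).1) hMre hHre
  -- Borel paths of the real combinations
  have hB1 : ∀ ω, Measurable fun r : ℝ => ∑ a ∈ s, (c a).re * (Hf a r.toNNReal ω).re := fun ω =>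
    Finset.measurable_sum s fun a ha => (hHre a ha ω).const_mul _
  have hB2 : ∀ ω, Measurable fun r : ℝ => ∑ a ∈ s, -(c a).im * (Hf a r.toNNReal ω).im := fun ω =>
    Finset.measurable_sum s fun a ha => (hHim a ha ω).const_mul _
  have hB3 : ∀ ω, Measurable fun r : ℝ => ∑ a ∈ s, (c a).re * (Hf a r.toNNReal ω).im := fun ω =>
    Finset.measurable_sum s fun a ha => (hHim a ha ω).const_mul _
  have hB4 : ∀ ω, Measurable fun r : ℝ => ∑ a ∈ s, (c a).im * (Hf a r.toNNReal ω).re := fun ω =>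
    Finset.measurable_sum s fun a ha => (hHre a ha ω).const_mul _
  have hre := h1.1.add_of_martingale h2.1 hB1 hB2 h1.2 h2.2
  have him := h3.1.add_of_martingale h4.1 hB3 hB4 h3.2 h4.2
  have hMre' := h1.2.add h2.2
  have hMim' := h3.2.add h4.2
  -- identification of real and imaginary parts of the complex combinations
  have eH_re : (fun t ω => (∑ a ∈ s, c a * Hf a t ω).re) =
      fun t ω => ∑ a ∈ s, (c a).re * (Hf a t ω).re + ∑ a ∈ s, -(c a).im * (Hf a t ω).im := by
    funext t ω
    rw [Complex.re_sum]
    simp only [Complex.mul_re]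
    rw [Finset.sum_sub_distrib, sub_eq_add_neg, ← Finset.sum_neg_distrib]
    simp only [neg_mul]
  have eJ_re : (fun t ω => (∑ a ∈ s, c a * Jf a t ω).re) =
      fun t ω => ∑ a ∈ s, (c a).re * (Jf a t ω).re + ∑ a ∈ s, -(c a).im * (Jf a t ω).im := by
    funext t ω
    rw [Complex.re_sum]
    simp only [Complex.mul_re]
    rw [Finset.sum_sub_distrib, sub_eq_add_neg, ← Finset.sum_neg_distrib]
    simp only [neg_mul]
  have eH_im : (fun t ω => (∑ a ∈ s, c a * Hf a t ω).im) =
      fun t ω => ∑ a ∈ s, (c a).re * (Hf a t ω).im + ∑ a ∈ s, (c a).im * (Hf a t ω).re := by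
    funext t ω
    simp only [Complex.im_sum, Complex.mul_im, Finset.sum_add_distrib]
  have eJ_im : (fun t ω => (∑ a ∈ s, c a * Jf a t ω).im) =
      fun t ω => ∑ a ∈ s, (c a).re * (Jf a t ω).im + ∑ a ∈ s, (c a).im * (Jf a t ω).re := by
    funext t ω
    simp only [Complex.im_sum, Complex.mul_im, Finset.sum_add_distrib]
  refine ⟨⟨?_, ?_⟩, ?_, ?_⟩
  · show IsItoIntegral (fun t ω => (∑ a ∈ s, c a * Hf a t ω).re) B (fun t ω => (∑ a ∈ s, c a * Jf a t ω).re) 𝓕 P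
    rw [eH_re, eJ_re]
    exact hre
  · show IsItoIntegral (fun t ω => (∑ a ∈ s, c a * Hf a t ω).im) B (fun t ω => (∑ a ∈ s, c a * Jf a t ω).im) 𝓕 P
    rw [eH_im, eJ_im]
    exact him
  · rw [eJ_re]
    exact hMre'
  · rw [eJ_im]
    exact hMim'

/-! ## Conjugation of a matrix of integrals by constant matrices -/

/-- Entry of a two-sided product as ONE sum over pairs of indices, coefficients first. [folklore] -/
private theorem mul_mul_apply_eq_sum_prod {n : Type*} [Fintype n] (A X C : Matrix n n ℂ) (i j : n) :
    (A * X * C) i j = ∑ p : n × n, (A i p.1 * C p.2 j) * X p.1 p.2 := by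
  rw [Fintype.sum_prod_type, Matrix.mul_apply, Finset.sum_comm]
  refine Finset.sum_congr rfl fun l _ => ?_
  rw [Matrix.mul_apply, Finset.sum_mul]
  refine Finset.sum_congr rfl fun k _ => ?_
  ring

/-- ★ **Conjugating a matrix of Itô integrals by constant matrices.**  If `I_{kl} = ∫ M_{kl} dB` entrywise
(`IsItoIntegralC`, real and imaginary parts martingales, Borel paths of `M`), then for constant matrices `A`, `C` the
entry `(A · I · C)_{ij}` is the Itô integral of `(A · M · C)_{ij}` against `B`, with martingale real and imaginary parts.
[cite: RevuzYor1999, Ch. IV Prop. (2.10)(i)] -/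
theorem IsItoIntegralC.conj_entry_of_martingale {n : Type*} [Fintype n] [Nonempty n]
    {M : ℝ≥0 → Ω → Matrix n n ℂ} {I : n → n → ℝ≥0 → Ω → ℂ}
    (hI : ∀ k l, IsItoIntegralC (fun t ω => M t ω k l) B (I k l) 𝓕 P)
    (hMre : ∀ k l, Martingale (fun t ω => (I k l t ω).re) 𝓕 P)
    (hMim : ∀ k l, Martingale (fun t ω => (I k l t ω).im) 𝓕 P)
    (hB : ∀ k l ω, Measurable fun r : ℝ => M r.toNNReal ω k l)
    (A C : Matrix n n ℂ) (i j : n) :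
    IsItoIntegralC (fun t ω => (A * M t ω * C) i j) B
        (fun t ω => (A * (Matrix.of fun k l => I k l t ω) * C) i j) 𝓕 P ∧
      Martingale (fun t ω => ((A * (Matrix.of fun k l => I k l t ω) * C) i j).re) 𝓕 P ∧
      Martingale (fun t ω => ((A * (Matrix.of fun k l => I k l t ω) * C) i j).im) 𝓕 P := by
  have h := IsItoIntegralC.sum_left_of_martingale (s := (Finset.univ : Finset (n × n))) Finset.univ_nonempty
    (fun p : n × n => A i p.1 * C p.2 j) (Hf := fun p t ω => M t ω p.1 p.2) (Jf := fun p t ω => I p.1 p.2 t ω)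
    (fun p _ => hI p.1 p.2) (fun p _ => hMre p.1 p.2) (fun p _ => hMim p.1 p.2) (fun p _ ω => hB p.1 p.2 ω)
  simp only [mul_mul_apply_eq_sum_prod, Matrix.of_apply]
  exact h

/-! ## Linear combinations of integrators -/

/-- ★ **`∫ H d(Σₐ cₐ Bₐ) = Σₐ cₐ ∫ H dBₐ` for a complex integrand** (real constants `cₐ`, nonempty finite family of
complex Itô integrals with martingale real and imaginary parts). [cite: RevuzYor1999, Ch. IV Thm. (2.2) and eq. (2.4)] -/
theorem IsItoIntegralC.sum_right_of_martingale [IsFiniteMeasure P] {ι : Type*} {s : Finset ι} (hs : s.Nonempty)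
    (c : ι → ℝ) {H : ℝ≥0 → Ω → ℂ} {Bf : ι → ℝ≥0 → Ω → ℝ} {Jf : ι → ℝ≥0 → Ω → ℂ}
    (hJ : ∀ a ∈ s, IsItoIntegralC H (Bf a) (Jf a) 𝓕 P)
    (hMre : ∀ a ∈ s, Martingale (fun t ω => (Jf a t ω).re) 𝓕 P)
    (hMim : ∀ a ∈ s, Martingale (fun t ω => (Jf a t ω).im) 𝓕 P) :
    IsItoIntegralC H (fun t ω => ∑ a ∈ s, c a * Bf a t ω) (fun t ω => ∑ a ∈ s, (c a : ℂ) * Jf a t ω) 𝓕 P := by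
  obtain ⟨a₀, ha₀⟩ := hs
  have hre := IsItoIntegral.sum_right_of_martingale s c (H := fun t ω => (H t ω).re) (Bf := Bf)
    (Jf := fun a t ω => (Jf a t ω).re) (fun a ha => (hJ a ha).1) hMre (hJ a₀ ha₀).1.2.2.2.1
  have him := IsItoIntegral.sum_right_of_martingale s c (H := fun t ω => (H t ω).im) (Bf := Bf)
    (Jf := fun a t ω => (Jf a t ω).im) (fun a ha => (hJ a ha).2) hMim (hJ a₀ ha₀).2.2.2.2.1
  have eJ_re : (fun t ω => (∑ a ∈ s, (c a : ℂ) * Jf a t ω).re) = fun t ω => ∑ a ∈ s, c a * (Jf a t ω).re := by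
    funext t ω
    simp only [Complex.re_sum, Complex.re_ofReal_mul]
  have eJ_im : (fun t ω => (∑ a ∈ s, (c a : ℂ) * Jf a t ω).im) = fun t ω => ∑ a ∈ s, c a * (Jf a t ω).im := by
    funext t ω
    simp only [Complex.im_sum, Complex.im_ofReal_mul]
  refine ⟨?_, ?_⟩
  · show IsItoIntegral (fun t ω => (H t ω).re) (fun t ω => ∑ a ∈ s, c a * Bf a t ω)
      (fun t ω => (∑ a ∈ s, (c a : ℂ) * Jf a t ω).re) 𝓕 P
    rw [eJ_re]
    exact hre
  · show IsItoIntegral (fun t ω => (H t ω).im) (fun t ω => ∑ a ∈ s, c a * Bf a t ω)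
      (fun t ω => (∑ a ∈ s, (c a : ℂ) * Jf a t ω).im) 𝓕 P
    rw [eJ_im]
    exact him

end Literature.MathematicalPhysics.QuantumFieldTheory

end
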